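import Literature.AlgebraicGeometry.Motives.CartierDivisorEffective
import Literature.AlgebraicGeometry.Motives.CyclesPushforwardProofs
import Literature.AlgebraicGeometry.Motives.CyclesPrincipalDivisorProofs
import Literature.AlgebraicGeometry.Motives.SubschemeCyclesPushPullProofs
import HarnessLib

/-!
# The degree of a Cartier divisor on an integral proper curve

For a Cartier divisor `D = (U_i, f_i)` (`Motives/CartierDivisor`, Görtz–Wedhorn I, Def. 11.20) on a
locally noetherian integral scheme `X`:

* `CartierDivisor.ordAt D x = ord_x(D)` — the order of vanishing (Mathlib `Scheme.ord`) of a local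
  equation `f_i`, `x ∈ U_i`, at `x`; independent of the chart (`ordAt_eq_ord`), invariant under
  `SameDivisor`, additive (`ordAt_add`, `ordAt_smul`), `ord_x(div h) = ord_x(h)`, `≥ 0` for
  effective `D` and `> 0` at a codimension-one point where the local equation is not a unit
  (`IsEffective.ordAt_pos`);
* `CartierDivisor.cycle D` — the associated Weil divisor `cyc(D) = Σ_x ord_x(D) [x̄]` as a Mathlib
  `AlgebraicCycle` (Görtz–Wedhorn I, (11.13.3)–(11.13.4): the homomorphism `cyc : Div(X) → Z¹(X)`;
  Fulton, *Intersection Theory*, §2.1), additive (`cycle_add`);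
* for a proper `K`-scheme `C` (`K` a field) — the case of interest being an integral proper curve —
  `CartierDivisor.degree C D = deg_K D = Σ_x ord_x(D) [κ(x) : K]` (`degree_eq_finsum`), implemented as
  the proper push-forward `p_* cyc(D)` along `p : C → Spec K` (Fulton, Def. 1.4: `deg α = ∫_C α`);
  it is additive (`degree_add`, `degree_smul`), **vanishes on principal divisors when `dim C = 1`**
  (`degree_principal`: Stacks 02RU / Fulton Prop. 1.4 (a) / Hartshorne II.6.10, here the theorem
  `map_div_eq_zero_of_dim_eq_add_one_holds` of `Motives/CyclesPushforwardProofs`), hence is an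
  invariant of the linear equivalence class (`LinEquiv.degree_eq`), is `≥ 0` on effective divisors
  and `> 0` on effective divisors having a genuine zero at a closed point (`IsEffective.degree_pos`,
  the residue degree of a closed point being finite and nonzero, `residueDegree_toSpecOver_ne_zero`);
* `IsEffective.pullbackAvoiding`, `IsEffective.not_isUnitAt_pullbackAvoiding` — pull-backs of
  effective divisors along arbitrary morphisms of integral schemes (`Motives/CartierDivisorClassPullback`)
  are effective, with zeros over the zeros.

This is the degree `deg : Pic(C) → ℤ` of line bundles on a proper curve in the concrete divisor
model of this directory (Görtz–Wedhorn II, (26.19); Hartshorne IV.1 over `K = K̄`), needed for the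
positivity of the Néron–Tate / Rosati-type quadratic forms on `Hom(A, B)` of abelian varieties
(`Motives/AbelianVarietyHomCurveForm`).

Mathlib searched (pin): `Scheme.ord`, `Scheme.ord_mul`, `Scheme.ord_eq_iff`, `Ring.ordFrac_of_isUnit`,
`Ring.ordFrac_ge_one_of_ne_zero`, `AlgebraicCycle.map`, `Function.locallyFinsupp.map_apply`,
`HasRingHomProperty.Spec_iff` (all used); Mathlib has no Cartier divisors, no `Pic`, no degree of
line bundles or divisors on curves (only `Polynomial.degree`-type notions), hence this file.

## References

* U. Görtz, T. Wedhorn, *Algebraic Geometry I: Schemes*, 2nd ed., Springer Spektrum (2020),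
  doi:10.1007/978-3-658-30733-2: Def. 11.20 (p. 373), (11.13.3)–(11.13.4) and Lemma 11.37
  (pp. 383–384; read via the held copy). [GortzWedhorn2020]
* W. Fulton, *Intersection Theory*, 2nd ed., Springer (1998): Def. 1.4 (p. 13: `deg(α) = ∫_X α =
  Σ n_P [R(P):K]`, "equivalently `deg(α) = p_*(α)`") and Prop. 1.4 (a), §2.1 (held copy, PDF pp. 24–25).
  [Fulton1998]
* The Stacks project, Tag 02RU (a principal divisor on a proper curve has degree `0`). [StacksProject]
* R. Hartshorne, *Algebraic Geometry*, GTM 52 (1977): II.6 (Cor. 6.10), IV.1. [Hartshorne1977]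
-/

universe u

open CategoryTheory AlgebraicGeometry Order Topology

noncomputable section

namespace Literature.AlgebraicGeometry.Motives

/-! ### Orders of vanishing of rational functions regular or invertible at a point -/

namespace RatFn

variable {X : Scheme.{u}} [IsIntegral X] [IsLocallyNoetherian X] {x : X} {h : X.functionField}

/-- A rational function which is a unit at `x` has order of vanishing `0` at `x`. [folklore] -/
theorem IsUnitAt.ord_eq_zero (hh : IsUnitAt x h) : Scheme.ord h x = 0 := by
  by_cases hx : coheight x = 1
  · obtain ⟨u, rfl⟩ := hh
    rw [Scheme.ord_eq_iff hx ((map_ne_zero_iff _ (toFunctionField_injective x)).mpr u.ne_zero)]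
    haveI : Ring.KrullDimLE 1 (X.presheaf.stalk x) := krullDimLE_of_coheight_le hx.le
    change Ring.ordFrac (X.presheaf.stalk x) (algebraMap _ X.functionField (u : X.presheaf.stalk x)) = _
    rw [Ring.ordFrac_of_isUnit u.isUnit]
    rfl
  · exact Scheme.ord_eq_zero_of_coheight_neq_one hx h

/-- A rational function regular at `x` has order of vanishing `≥ 0` at `x`. [folklore] -/
theorem IsRegularAt.ord_nonneg (hh : IsRegularAt x h) : 0 ≤ Scheme.ord h x := by
  by_cases h0 : h = 0
  · subst h0; simp
  by_cases hx : coheight x = 1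
  · obtain ⟨t, rfl⟩ := hh
    have ht : t ≠ 0 := fun ht => h0 (by rw [ht, map_zero])
    rw [Scheme.le_ord_iff hx h0]
    haveI : Ring.KrullDimLE 1 (X.presheaf.stalk x) := krullDimLE_of_coheight_le hx.le
    change Multiplicative.ofAdd (0 : ℤ) ≤
      Ring.ordFrac (X.presheaf.stalk x) (algebraMap _ X.functionField t)
    exact Ring.ordFrac_ge_one_of_ne_zero ht
  · rw [Scheme.ord_eq_zero_of_coheight_neq_one hx h]

/-- A rational function regular but not invertible at a codimension-one point `x` has order of
vanishing `≥ 1` at `x` (its local equation generates a proper ideal of `𝒪_{X,x}`, of positive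
length). [folklore] -/
theorem IsRegularAt.ord_pos (hh : IsRegularAt x h) (hu : ¬ IsUnitAt x h) (h0 : h ≠ 0)
    (hx : coheight x = 1) : 0 < Scheme.ord h x := by
  obtain ⟨t, rfl⟩ := hh
  have ht : t ≠ 0 := fun ht => h0 (by rw [ht, map_zero])
  have htu : ¬ IsUnit t := fun htu => hu ⟨htu.unit, rfl⟩
  haveI : Ring.KrullDimLE 1 (X.presheaf.stalk x) := krullDimLE_of_coheight_le hx.le
  have ht' : t ∈ nonZeroDivisors (X.presheaf.stalk x) := mem_nonZeroDivisors_of_ne_zero ht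
  -- `ord t = n` with `n ≥ 1`
  obtain ⟨n, hn⟩ := ENat.ne_top_iff_exists.mp (Ring.ord_ne_top ht')
  have hn1 : n ≠ 0 := by
    rintro rfl
    have h1 : Ring.ord (X.presheaf.stalk x) t = 0 := by rw [← hn]; rfl
    unfold Ring.ord at h1
    rw [Module.length_eq_zero_iff] at h1
    apply htu
    rw [← Ideal.span_singleton_eq_top]
    exact Ideal.Quotient.subsingleton_iff.mp h1
  have key : Scheme.ord (toFunctionField x t) x = n := by
    rw [Scheme.ord_eq_iff hx h0]
    change Ring.ordFrac (X.presheaf.stalk x) (algebraMap _ X.functionField t) = _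
    rw [Ring.ordFrac_eq_ord _ ht, Ring.ordMonoidWithZeroHom_eq_coe _ ht' hn.symm]
  rw [key]
  exact_mod_cast Nat.pos_of_ne_zero hn1

end RatFn

/-! ### The order of a Cartier divisor at a point and its Weil cycle -/

namespace CartierDivisor

open RatFn

variable {X : Scheme.{u}} [IsIntegral X] [IsLocallyNoetherian X]

/-- The **order `ord_x(D)` of a Cartier divisor `D = (U_i, f_i)` at a point `x`**: the order of
vanishing at `x` (Mathlib `Scheme.ord`, zero unless `x` has codimension one) of a local equation
`f_i`, `x ∈ U_i` — independent of the chart since `f_i / f_j ∈ 𝒪_{X,x}^×` (`ordAt_eq_ord`). This is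
the coefficient of `[x̄]` in the Weil divisor `cyc(D) = Σ ord_x(D) [x̄]` attached to `D`
(Görtz–Wedhorn I, (11.13.3): "the vanishing order of `D` at `C`", with Lemma 11.37: `ord` is a
homomorphism killing units; Fulton, *Intersection Theory*, §2.1, "the associated Weil divisor
`[D] = Σ ord_V(D) [V]`"). [cite: GortzWedhorn2020, (11.13.3) and Lemma 11.37 (pp. 383–384)] -/
def ordAt (D : CartierDivisor X) (x : X) : ℤ :=
  Scheme.ord (D.f (D.covers x).choose) x

/-- `ord_x(D)` may be computed with any local equation `f_i`, `x ∈ U_i`. [folklore] -/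
theorem ordAt_eq_ord (D : CartierDivisor X) {x : X} {i : D.ι} (hi : x ∈ D.U i) :
    D.ordAt x = Scheme.ord (D.f i) x := by
  have hj : x ∈ D.U (D.covers x).choose := (D.covers x).choose_spec
  have hu := D.isUnitAt_div (D.covers x).choose i x hj hi
  unfold ordAt
  calc Scheme.ord (D.f (D.covers x).choose) x
      = Scheme.ord (D.f (D.covers x).choose / D.f i * D.f i) x := by
          rw [div_mul_cancel₀ _ (D.f_ne_zero i)]
    _ = Scheme.ord (D.f (D.covers x).choose / D.f i) x + Scheme.ord (D.f i) x :=
          Scheme.ord_mul (div_ne_zero (D.f_ne_zero _) (D.f_ne_zero i)) (D.f_ne_zero i)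
    _ = Scheme.ord (D.f i) x := by rw [hu.ord_eq_zero, zero_add]

/-- Presentations of the same divisor have the same orders. [folklore] -/
theorem SameDivisor.ordAt_eq {D E : CartierDivisor X} (h : D.SameDivisor E) (x : X) :
    D.ordAt x = E.ordAt x := by
  obtain ⟨i, hi⟩ := D.covers x
  obtain ⟨j, hj⟩ := E.covers x
  rw [D.ordAt_eq_ord hi, E.ordAt_eq_ord hj]
  calc Scheme.ord (D.f i) x = Scheme.ord (D.f i / E.f j * E.f j) x := by
        rw [div_mul_cancel₀ _ (E.f_ne_zero j)]
    _ = Scheme.ord (D.f i / E.f j) x + Scheme.ord (E.f j) x :=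
        Scheme.ord_mul (div_ne_zero (D.f_ne_zero i) (E.f_ne_zero j)) (E.f_ne_zero j)
    _ = Scheme.ord (E.f j) x := by rw [(h i j x hi hj).ord_eq_zero, zero_add]

/-- `ord_x(D + E) = ord_x(D) + ord_x(E)`. [folklore] -/
theorem ordAt_add (D E : CartierDivisor X) (x : X) : (D + E).ordAt x = D.ordAt x + E.ordAt x := by
  obtain ⟨i, hi⟩ := D.covers x
  obtain ⟨j, hj⟩ := E.covers x
  rw [(D + E).ordAt_eq_ord (i := (i, j)) ⟨hi, hj⟩, D.ordAt_eq_ord hi, E.ordAt_eq_ord hj]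
  exact Scheme.ord_mul (D.f_ne_zero i) (E.f_ne_zero j)

omit [IsLocallyNoetherian X] in
/-- `ord (f ^ n) = n • ord f` for a nonzero rational function. [folklore] -/
theorem _root_.Literature.AlgebraicGeometry.Motives.RatFn.ord_pow [IsLocallyNoetherian X]
    {f : X.functionField} (hf : f ≠ 0) (x : X) (n : ℕ) :
    Scheme.ord (f ^ n) x = n * Scheme.ord f x := by
  induction n with
  | zero =>
    rw [pow_zero, Nat.cast_zero, zero_mul]
    exact isUnitAt_one.ord_eq_zero
  | succ n ih =>
    rw [pow_succ, Scheme.ord_mul (pow_ne_zero n hf) hf, ih]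
    push_cast
    ring

/-- `ord_x(n • D) = n · ord_x(D)`. [folklore] -/
theorem ordAt_smul (D : CartierDivisor X) (n : ℕ) (x : X) : (n • D).ordAt x = n * D.ordAt x := by
  obtain ⟨i, hi⟩ := D.covers x
  rw [(n • D).ordAt_eq_ord (i := i) hi, D.ordAt_eq_ord hi, smul_f]
  exact RatFn.ord_pow (D.f_ne_zero i) x n

/-- The order of a principal divisor `div(h)` at `x` is `ord_x(h)`. [folklore] -/
@[simp]
theorem ordAt_principal {h : X.functionField} (hh : h ≠ 0) (x : X) :
    (principal h hh).ordAt x = Scheme.ord h x :=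
  (principal h hh).ordAt_eq_ord (i := PUnit.unit) trivial

/-- The zero divisor has order `0` everywhere. [folklore] -/
@[simp]
theorem ordAt_zero (x : X) : (0 : CartierDivisor X).ordAt x = 0 := by
  rw [show (0 : CartierDivisor X) = principal 1 one_ne_zero from rfl, ordAt_principal]
  exact isUnitAt_one.ord_eq_zero

/-- An effective divisor has nonnegative orders. [folklore] -/
theorem IsEffective.ordAt_nonneg {D : CartierDivisor X} (hD : D.IsEffective) (x : X) :
    0 ≤ D.ordAt x := by
  obtain ⟨i, hi⟩ := D.covers x
  rw [D.ordAt_eq_ord hi]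
  exact (hD i x hi).ord_nonneg

/-- An effective divisor whose local equation is not a unit at a codimension-one point `x` has
positive order at `x`. [folklore] -/
theorem IsEffective.ordAt_pos {D : CartierDivisor X} (hD : D.IsEffective) {x : X} {i : D.ι}
    (hi : x ∈ D.U i) (hu : ¬ IsUnitAt x (D.f i)) (hx : coheight x = 1) : 0 < D.ordAt x := by
  rw [D.ordAt_eq_ord hi]
  exact (hD i x hi).ord_pos hu (D.f_ne_zero i) hx

/-- A divisor avoiding `x` (`x ∉ Supp D`) has order `0` at `x`. [folklore] -/
theorem Avoids.ordAt_eq_zero {D : CartierDivisor X} {x : X} (hD : D.Avoids x) : D.ordAt x = 0 := by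
  obtain ⟨i, hi⟩ := D.covers x
  rw [D.ordAt_eq_ord hi]
  exact (hD i hi).ord_eq_zero

/-- **The Weil divisor `cyc(D) = Σ ord_x(D) [x̄]` of a Cartier divisor** on a locally noetherian
integral scheme, as an algebraic cycle (Mathlib `AlgebraicCycle`: a function with locally finite
support): its coefficient at `x` is `ord_x(D)`; the support is locally finite because on the chart
`U_i` it is that of the principal divisor `div(f_i)` (`locallyFiniteSupport_ord`, Stacks 02RL)
(Görtz–Wedhorn I, (11.13.4): the homomorphism `cyc : Div(X) → Z¹(X)`, "only finitely many `C ∈ X¹`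
such that `ord_C(D) ≠ 0`"; Fulton, *Intersection Theory*, §2.1). [cite: GortzWedhorn2020, (11.13.4) (p. 384)] -/
def cycle (D : CartierDivisor X) : AlgebraicCycle X ℤ where
  toFun := D.ordAt
  supportWithinDomain' := Set.subset_univ _
  supportLocallyFiniteWithinDomain' z _ := by
    obtain ⟨i, hi⟩ := D.covers z
    obtain ⟨t, ht, hfin⟩ := locallyFiniteSupport_ord (X := X) (D.f i) z
    refine ⟨t ∩ D.U i, Filter.inter_mem ht ((D.U i).2.mem_nhds hi), hfin.subset ?_⟩
    rintro y ⟨⟨hyt, hyU⟩, hy⟩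
    refine ⟨hyt, ?_⟩
    rw [Function.mem_support] at hy ⊢
    rwa [D.ordAt_eq_ord hyU] at hy

/-- The coefficient of `cyc(D)` at `x` is `ord_x(D)`. [folklore] -/
@[simp]
theorem cycle_apply (D : CartierDivisor X) (x : X) : D.cycle x = D.ordAt x := rfl

/-- `cyc` respects `SameDivisor`. [folklore] -/
theorem SameDivisor.cycle_eq {D E : CartierDivisor X} (h : D.SameDivisor E) : D.cycle = E.cycle := by
  ext x; exact h.ordAt_eq x

/-- `cyc(D + E) = cyc(D) + cyc(E)` (Görtz–Wedhorn I, (11.13.4): "Lemma 11.37 shows that cyc is a group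
homomorphism"). [cite: GortzWedhorn2020, (11.13.4) (p. 384)] -/
theorem cycle_add (D E : CartierDivisor X) : (D + E).cycle = D.cycle + E.cycle := by
  ext x; exact ordAt_add D E x

/-- `cyc(div h) = div(h)` has coefficients `ord_x(h)`. [folklore] -/
theorem coe_cycle_principal {h : X.functionField} (hh : h ≠ 0) :
    ⇑(principal h hh).cycle = fun x => Scheme.ord h x := by
  ext x; exact ordAt_principal hh x

/-! ### The degree of a Cartier divisor on an integral proper curve over a field -/

section Degree

variable {K : Type u} [Field K]

/-- A `K`-scheme locally of finite type is locally noetherian (Mathlib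
`LocallyOfFiniteType.isLocallyNoetherian`; an instance keyed on `K`-schemes `C : SchemeOver K`, as
`isLocallyNoetherian_baseChangeHom_obj_left` of `Motives/CyclesBaseChange`). [folklore] -/
instance isLocallyNoetherian_left (C : SchemeOver K) [LocallyOfFiniteType C.hom] :
    IsLocallyNoetherian C.left :=
  LocallyOfFiniteType.isLocallyNoetherian C.hom

/-- `Spec K` is integral. [folklore] -/
instance isIntegral_specOver_self_left : IsIntegral (specOver K K).left :=
  inferInstanceAs (IsIntegral (Spec (CommRingCat.of K)))

/-- The structure morphism `Spec K → Spec K` (an isomorphism) is locally of finite type. [folklore] -/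
instance locallyOfFiniteType_specOver_self_hom : LocallyOfFiniteType (specOver K K).hom := by
  change LocallyOfFiniteType (Spec.map (CommRingCat.ofHom (algebraMap K K)))
  rw [HasRingHomProperty.Spec_iff (P := @LocallyOfFiniteType)]
  exact RingHom.FiniteType.id K

/-- `Spec K` has dimension `0`: its (unique) point has height `0`. [folklore] -/
theorem height_top_specOver_self : height (⊤ : ↥(specOver K K).left) = 0 := by
  haveI : Subsingleton ↥(specOver K K).left := inferInstanceAs (Subsingleton (PrimeSpectrum K))
  rw [Order.height_eq_zero]
  intro b _
  exact (Subsingleton.elim (⊤ : ↥(specOver K K).left) b).le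

variable (C : SchemeOver K) [IsIntegral C.left] [IsProper C.hom]

/-- The underlying morphism of `toSpecOver C` is the (proper) structure morphism. [folklore] -/
instance isProper_toSpecOver_left : IsProper (toSpecOver C).left := inferInstanceAs (IsProper C.hom)

/-- The structure morphism of a proper `K`-scheme is quasi-compact. [folklore] -/
instance quasiCompact_toSpecOver_left : QuasiCompact (toSpecOver C).left :=
  inferInstanceAs (QuasiCompact C.hom)

/-- The structure morphism of a nonempty `K`-scheme is dominant (`Spec K` is a point). [folklore] -/
instance isDominant_toSpecOver_left : IsDominant (toSpecOver C).left := by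
  haveI : Subsingleton ↥(specOver K K).left := inferInstanceAs (Subsingleton (PrimeSpectrum K))
  exact ⟨Function.Surjective.denseRange fun s => ⟨(⊤ : ↥C.left), Subsingleton.elim _ _⟩⟩

/-- **The degree of a Cartier divisor `D` on a proper `K`-scheme `C`** (of interest for `C` an
integral proper curve): `deg_K D = Σ_x ord_x(D) [κ(x) : K]`, the sum over the closed points of `C` —
implemented as the coefficient of the proper push-forward `p_* cyc(D)` of the Weil cycle of `D`
along the structure morphism `p : C → Spec K` (Mathlib `AlgebraicCycle.map` with the dimension
weights `Order.height`; Fulton, *Intersection Theory*, Def. 1.4: `deg(α) = ∫ α = p_*(α)` for a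
`0`-cycle on a complete scheme, `deg [P] = [κ(P) : K]`; Görtz–Wedhorn II, (26.19) for divisors on
curves; Hartshorne IV.1 for curves over `K = K̄`). [cite: Fulton1998, Definition 1.4 (p. 13)] -/
def degree (D : CartierDivisor C.left) : ℤ :=
  AlgebraicCycle.map (toSpecOver C).left Order.height Order.height D.cycle ⊤

variable {C}

/-- The degree only depends on the divisor, not on its presentation. [folklore] -/
theorem SameDivisor.degree_eq {D E : CartierDivisor C.left} (h : D.SameDivisor E) :
    degree C D = degree C E := by
  unfold degree; rw [h.cycle_eq]

variable (C) in
/-- **The degree is additive**: `deg (D + E) = deg D + deg E`. [folklore] -/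
theorem degree_add (D E : CartierDivisor C.left) : degree C (D + E) = degree C D + degree C E := by
  unfold degree
  rw [cycle_add, algebraicCycleMap_add]
  rfl

variable (C) in
/-- **A principal divisor on an integral proper curve has degree zero** (Stacks 02RU; Fulton,
*Intersection Theory*, Prop. 1.4 (a); Hartshorne II.6.10 / IV.1): the proper push-forward of
`div(h)` along `C → Spec K` vanishes — the theorem `map_div_eq_zero_of_dim_eq_add_one_holds` of
`Motives/CyclesPushforwardProofs` (relative dimension one). [cite: StacksProject, Tag 02RU] -/
theorem degree_principal (hC : height (⊤ : ↥C.left) = 1) {h : C.left.functionField} (hh : h ≠ 0) :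
    degree C (principal h hh) = 0 := by
  unfold degree
  have key := map_div_eq_zero_of_dim_eq_add_one_holds (p := toSpecOver C) 0
    (by rw [hC]; rfl) height_top_specOver_self h hh (principal h hh).cycle (coe_cycle_principal hh)
  change (AlgebraicCycle.map (toSpecOver C).left height height (principal h hh).cycle) ⊤ = 0
  rw [key]
  rfl

/-- **Linearly equivalent divisors on an integral proper curve have the same degree.**
[cite: StacksProject, Tag 02RU] -/
theorem LinEquiv.degree_eq (hC : height (⊤ : ↥C.left) = 1) {D E : CartierDivisor C.left}
    (H : D.LinEquiv E) : degree C D = degree C E := by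
  obtain ⟨h, hh, hDE⟩ := H
  rw [← hDE.degree_eq, degree_add, degree_principal C hC hh, add_zero]

/-- The zero divisor has degree `0`. [folklore] -/
@[simp]
theorem degree_zero : degree C (0 : CartierDivisor C.left) = 0 := by
  unfold degree
  have : (0 : CartierDivisor C.left).cycle = 0 := by ext x; simp
  rw [this, algebraicCycleMap_zero]
  rfl

variable (C) in
/-- `deg (n • D) = n · deg D`. [folklore] -/
theorem degree_smul (D : CartierDivisor C.left) (n : ℕ) : degree C (n • D) = n * degree C D := by
  induction n with
  | zero =>
    rw [Nat.cast_zero, zero_mul]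
    exact (zero_smul_sameDivisor D).degree_eq.trans degree_zero
  | succ n ih =>
    rw [(add_smul_sameDivisor D n 1).degree_eq, degree_add, ih, one_smul]
    push_cast; ring

/-! #### The degree as a sum over closed points; positivity -/

/-- The support of the Weil cycle of a divisor on a proper `K`-scheme is finite. [folklore] -/
theorem finite_support_cycle (D : CartierDivisor C.left) : (Function.support D.cycle).Finite := by
  haveI : Subsingleton ↥(specOver K K).left := inferInstanceAs (Subsingleton (PrimeSpectrum K))
  have h := finite_preimage_singleton_inter_support (toSpecOver C).left D.cycle ⊤
  rwa [show (toSpecOver C).left.base ⁻¹' {⊤} = Set.univ from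
    Set.eq_univ_of_forall fun x => Subsingleton.elim _ _, Set.univ_inter] at h

omit [IsIntegral C.left] in
/-- The push-forward weight of `C → Spec K` at `x` is the residue degree `[κ(x) : K]` (zero if
infinite). [folklore] -/
theorem mapCoeff_toSpecOver_eq (x : C.left) :
    AlgebraicCycle.mapCoeff (toSpecOver C).left height height x = (toSpecOver C).left.residueDegree x :=
  mapCoeff_height_eq_residueDegree (toSpecOver C).left (specOver K K).hom x

/-- **`deg_K D = Σ_x ord_x(D) [κ(x) : K]`**, the (finite) sum over all points of `C`, only closed
points contributing (Fulton, *Intersection Theory*, Def. 1.4). [cite: Fulton1998, Definition 1.4 (p. 13)] -/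
theorem degree_eq_finsum (D : CartierDivisor C.left) :
    degree C D = ∑ᶠ x, D.ordAt x * ((toSpecOver C).left.residueDegree x : ℤ) := by
  haveI : Subsingleton ↥(specOver K K).left := inferInstanceAs (Subsingleton (PrimeSpectrum K))
  unfold degree AlgebraicCycle.map
  rw [Function.locallyFinsupp.map_apply,
    show (toSpecOver C).left.base ⁻¹' {⊤} = Set.univ from Set.eq_univ_of_forall fun x => Subsingleton.elim _ _,
    finsum_mem_univ]
  refine finsum_congr fun x => ?_
  rw [mapCoeff_toSpecOver_eq, cycle_apply]

omit [IsIntegral C.left] in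
/-- **A closed point of a `K`-scheme locally of finite type has finite residue extension**
`κ(x) / K`, i.e. nonzero residue degree (Zariski's lemma / Nullstellensatz; via
`residueDegree_ne_zero_of_height_asFiber_eq_zero`). [folklore] -/
theorem residueDegree_toSpecOver_ne_zero {x : C.left} (hx : height x = 0) :
    (toSpecOver C).left.residueDegree x ≠ 0 := by
  haveI : Subsingleton ↥(specOver K K).left := inferInstanceAs (Subsingleton (PrimeSpectrum K))
  refine residueDegree_ne_zero_of_height_asFiber_eq_zero (toSpecOver C).left x ?_
  have h := Scheme.height_eq_height_add_height_asFiber (toSpecOver C).left (specOver K K).hom x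
  have h0 : height ((toSpecOver C).left x) = 0 := by
    rw [Order.height_eq_zero]
    intro b _
    exact (Subsingleton.elim ((toSpecOver C).left x) b).le
  rw [hx, h0, zero_add] at h
  exact h.symm

/-- **An effective divisor has nonnegative degree.** [folklore] -/
theorem IsEffective.degree_nonneg {D : CartierDivisor C.left} (hD : D.IsEffective) :
    0 ≤ degree C D := by
  rw [degree_eq_finsum]
  exact finsum_nonneg fun x => mul_nonneg (hD.ordAt_nonneg x) (Nat.cast_nonneg _)

/-- On a one-dimensional integral `K`-scheme, closed points have codimension one. [folklore] -/
theorem coheight_eq_one_of_height_eq_zero (hC : height (⊤ : ↥C.left) = 1) {x : C.left}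
    (hx : height x = 0) : coheight x = 1 := by
  have h := Scheme.height_add_coheight_eq_height_top C.hom x
  rw [hx, hC, zero_add] at h
  exact h

/-- **An effective divisor with a genuine zero has positive degree**: if `D ≥ 0` on the integral
proper curve `C` and some local equation `f_i` is not a unit at a closed point `x ∈ U_i`, then
`deg D ≥ ord_x(D) [κ(x) : K] ≥ 1`. [folklore] -/
theorem IsEffective.degree_pos (hC : height (⊤ : ↥C.left) = 1) {D : CartierDivisor C.left}
    (hD : D.IsEffective) {x : C.left} {i : D.ι} (hi : x ∈ D.U i) (hu : ¬ IsUnitAt x (D.f i))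
    (hx : height x = 0) : 0 < degree C D := by
  rw [degree_eq_finsum]
  have hfin : (Function.support fun y => D.ordAt y * ((toSpecOver C).left.residueDegree y : ℤ)).Finite :=
    (finite_support_cycle D).subset (Function.support_mul_subset_left _ _)
  rw [finsum_eq_sum _ hfin]
  have hxpos : 0 < D.ordAt x * ((toSpecOver C).left.residueDegree x : ℤ) :=
    mul_pos (hD.ordAt_pos hi hu (coheight_eq_one_of_height_eq_zero hC hx))
      (by exact_mod_cast Nat.pos_of_ne_zero (residueDegree_toSpecOver_ne_zero hx))
  have hxmem : x ∈ hfin.toFinset := by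
    rw [Set.Finite.mem_toFinset, Function.mem_support]
    exact hxpos.ne'
  calc (0 : ℤ) < D.ordAt x * ((toSpecOver C).left.residueDegree x : ℤ) := hxpos
    _ ≤ ∑ y ∈ hfin.toFinset, D.ordAt y * ((toSpecOver C).left.residueDegree y : ℤ) :=
        Finset.single_le_sum (fun y _ => mul_nonneg (hD.ordAt_nonneg y) (Nat.cast_nonneg _)) hxmem

end Degree

/-! ### Pull-back of effective divisors along arbitrary morphisms -/

section EffectivePullback

variable {Y : Scheme.{u}} [IsIntegral Y] (g : Y ⟶ X)

omit [IsLocallyNoetherian X] in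
/-- The pull-back `g^*D` of an effective divisor `D` avoiding `g(η_Y)` along an arbitrary morphism
`g : Y → X` of integral schemes is effective (its local equations `g^♯ f_i` are regular). [folklore] -/
theorem IsEffective.pullbackAvoiding {D : CartierDivisor X} (hD : D.IsEffective)
    (hDg : D.Avoids (g (genericPoint Y))) : (D.pullbackAvoiding g hDg).IsEffective :=
  fun i y hy => (hD i.1 (g y) hy).pullbackFn

omit [IsLocallyNoetherian X] in
/-- If a local equation `f_i` of the effective divisor `D` is not a unit at `g(y)`, `y ∈ g⁻¹ U_i`,
then the local equation `g^♯ f_i` of `g^*D` is not a unit at `y` (stalk maps are local).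
[folklore] -/
theorem IsEffective.not_isUnitAt_pullbackAvoiding {D : CartierDivisor X} (hD : D.IsEffective)
    (hDg : D.Avoids (g (genericPoint Y))) {y : Y} (i : (D.pullbackAvoiding g hDg).ι)
    (hy : y ∈ (D.pullbackAvoiding g hDg).U i) (hu : ¬ IsUnitAt (g y) (D.f i.1)) :
    ¬ IsUnitAt y ((D.pullbackAvoiding g hDg).f i) := fun h =>
  hu ((hD i.1 (g y) hy).isUnitAt_of_pullbackFn h)

omit [IsLocallyNoetherian X] in
/-- The divisor `D + div(s)` of a section `s` of `𝒪_X(D)` avoids `x` iff `x` lies in the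
non-vanishing locus `X_s` (both say: `f_i s ∈ 𝒪_{X,x}^×`). [folklore] -/
theorem avoids_add_principal_iff (D : CartierDivisor X) {s : X.functionField} (hs : s ≠ 0) {x : X} :
    (D + principal s hs).Avoids x ↔ x ∈ D.nonvanishing s := by
  constructor
  · intro h
    obtain ⟨i, hi⟩ := D.covers x
    exact ⟨i, hi, h (i, PUnit.unit) ⟨hi, trivial⟩⟩
  · rintro hx ⟨i, u⟩ ⟨hi, -⟩
    exact (D.mem_nonvanishing_iff hi).1 hx

end EffectivePullback

end CartierDivisor

end Literature.AlgebraicGeometry.Motives
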